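import Summits.Ventures.WeilGRH.UniformConductorFloorCellsEightyB
import Summits.Ventures.WeilGRH.UniformConductorFloorCellsEightyC
import Summits.Ventures.WeilGRH.UniformConductorFloorCellsEightyD
import Summits.Ventures.WeilGRH.UniformConductorFloorLorentzLayers
import Summits.Ventures.WeilGRH.UniformConductorFloorLorentzRungs
import HarnessLib

/-!
# GRH arm (rh-explicit, venture WeilGRH): the `t = 1` floor with `J = 80` cells and two Lévy layers — every character mod `q ≥ 144`

Cell `rh-explicit`, WEIL TRACK — GRH ARM (weil-grh-1).  `UniformFloor.weilPositivityOnChar_of_phi_budget_layers` with the `J = 80`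
certificate (`ρ = 2.0866`) and `M = 2` archimedean layers (`γ = 4e^{−1/2} + (4/5)e^{−5/2} ≥ 2.4916` even,
`(4/3)e^{−3/2} + (4/7)e^{−7/2} ≥ 0.3147` odd): budgets `4.9671 ≤ log 144`, `4.0025 ≤ log 56`.
**Weil positivity on `[-1, 1]` for EVERY Dirichlet character of EVERY modulus `q ≥ 144` (odd characters: `q ≥ 56`)**,
certificate-free, uniform in the character's values, no `ζ` input (method floors `143.6` / `54.7`; sharp data floors `75` / `30`).

## References

* A. Weil (1952), (11) and the «lemme» p. 262 [Weil1952FormulesExplicites]; H. Yoshida (1992) §2, §6 [Yoshida1992].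
-/

noncomputable section

open Complex Filter Set MeasureTheory
open scoped Real Topology ComplexConjugate ArithmeticFunction.vonMangoldt

namespace Summit.Ventures.WeilGRH

open Literature.NumberTheory.LFunctions

namespace UniformFloor

variable {q : ℕ}

/-! ## The assembled `J = 80` certificate -/

/-- **The `one80` certificate**: all `80` cell inequalities `Σ_n w̄_n (A_{n,j} + B_{n,j}) ≤ ρ φ_j`. [folklore] -/
theorem one80_cert : ∀ j ∈ Finset.range 80,
    ∑ n ∈ Finset.range (7 + 1), wbar7 n *
      (max (phiOne80 ((j : ℤ) - sOne80 n - 1)) (phiOne80 ((j : ℤ) - sOne80 n)) +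
        max (phiOne80 ((j : ℤ) + sOne80 n)) (phiOne80 ((j : ℤ) + sOne80 n + 1))) ≤ (10433 / 5000 : ℝ) * phiOne80 (j : ℤ) := by
  intro j hj
  rw [Finset.mem_range] at hj
  interval_cases j
  exacts [one80_cell_0, one80_cell_1, one80_cell_2, one80_cell_3, one80_cell_4, one80_cell_5, one80_cell_6, one80_cell_7, one80_cell_8, one80_cell_9, one80_cell_10, one80_cell_11, one80_cell_12, one80_cell_13, one80_cell_14, one80_cell_15, one80_cell_16, one80_cell_17, one80_cell_18, one80_cell_19, one80_cell_20, one80_cell_21, one80_cell_22, one80_cell_23, one80_cell_24, one80_cell_25, one80_cell_26, one80_cell_27, one80_cell_28, one80_cell_29, one80_cell_30, one80_cell_31, one80_cell_32, one80_cell_33, one80_cell_34, one80_cell_35, one80_cell_36, one80_cell_37, one80_cell_38, one80_cell_39, one80_cell_40, one80_cell_41, one80_cell_42, one80_cell_43, one80_cell_44, one80_cell_45, one80_cell_46, one80_cell_47, one80_cell_48, one80_cell_49, one80_cell_50, one80_cell_51, one80_cell_52, one80_cell_53, one80_cell_54, one80_cell_55, one80_cell_56, one80_cell_57, one80_cell_58,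 one80_cell_59, one80_cell_60, one80_cell_61, one80_cell_62, one80_cell_63, one80_cell_64, one80_cell_65, one80_cell_66, one80_cell_67, one80_cell_68, one80_cell_69, one80_cell_70, one80_cell_71, one80_cell_72, one80_cell_73, one80_cell_74, one80_cell_75, one80_cell_76, one80_cell_77, one80_cell_78, one80_cell_79]

/-! ## The two-layer gains -/

/-- `e^{−5/2} ≥ 0.08208` (`= e^{−1}·e^{−1}·e^{−1/2}`). [folklore] -/
theorem exp_neg_five_halves_ge : (0.08208 : ℝ) ≤ Real.exp (-(5 / 2)) := by
  have h1 := Real.exp_neg_one_gt_d9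
  have h2 := exp_neg_half_ge
  have e : Real.exp (-(5 / 2)) = Real.exp (-1) * Real.exp (-1) * Real.exp (-(1 / 2)) := by
    rw [← Real.exp_add, ← Real.exp_add]; norm_num
  rw [e]
  have h0 : 0 ≤ Real.exp (-1) := (Real.exp_pos _).le
  nlinarith [mul_le_mul h1.le h1.le (by norm_num) h0]

/-- `e^{−7/2} ≥ 0.03019` (`= e^{−1}·e^{−5/2}`). [folklore] -/
theorem exp_neg_seven_halves_ge : (0.03019 : ℝ) ≤ Real.exp (-(7 / 2)) := by
  have h1 := Real.exp_neg_one_gt_d9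
  have h2 := exp_neg_five_halves_ge
  have e : Real.exp (-(7 / 2)) = Real.exp (-1) * Real.exp (-(5 / 2)) := by
    rw [← Real.exp_add]; norm_num
  rw [e]
  nlinarith [(Real.exp_pos (-(5/2 : ℝ))).le]

/-- `γ` at `t = 1`, even, two layers: `2.4916 ≤ 4e^{−1/2} + (4/5)e^{−5/2}`. [folklore] -/
theorem gamma_one_even_two_layers : (2.4916 : ℝ) ≤ ∑ m ∈ Finset.range 2,
    Real.exp (-(2 * ((m : ℝ) + (1 / 4 + ((0 : ℕ) : ℝ) / 2)) * 1)) / ((m : ℝ) + (1 / 4 + ((0 : ℕ) : ℝ) / 2)) := by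
  have h1 := exp_neg_half_ge
  have h2 := exp_neg_five_halves_ge
  simp only [Finset.sum_range_succ, Finset.sum_range_zero, Nat.cast_zero, Nat.cast_one]
  norm_num
  linarith

/-- `γ` at `t = 1`, odd, two layers: `0.3147 ≤ (4/3)e^{−3/2} + (4/7)e^{−7/2}`. [folklore] -/
theorem gamma_one_odd_two_layers : (0.3147 : ℝ) ≤ ∑ m ∈ Finset.range 2,
    Real.exp (-(2 * ((m : ℝ) + (1 / 4 + ((1 : ℕ) : ℝ) / 2)) * 1)) / ((m : ℝ) + (1 / 4 + ((1 : ℕ) : ℝ) / 2)) := by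
  have h1 := exp_neg_half_ge
  have h2 := Real.exp_neg_one_gt_d9
  have h3 := exp_neg_seven_halves_ge
  have e1 : Real.exp (-(3 / 2)) = Real.exp (-1) * Real.exp (-(1 / 2)) := by rw [← Real.exp_add]; norm_num
  simp only [Finset.sum_range_succ, Finset.sum_range_zero, Nat.cast_zero, Nat.cast_one]
  norm_num
  rw [e1]
  have h0 : 0 ≤ Real.exp (-1) := (Real.exp_pos _).le
  nlinarith [mul_le_mul h2.le h1 (by norm_num) h0, h3]

/-! ## The floors -/

/-- `log 144 ≥ 4.9698132` and `log 56 ≥ 4.0160258`. [folklore] -/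
theorem log_144_56_ge : (4.9698132 : ℝ) ≤ Real.log 144 ∧ (4.0160258 : ℝ) ≤ Real.log 56 := by
  have h2 := Real.log_two_gt_d9
  have h3 := Real.log_three_gt_d9
  have h7 := log_seven_ge
  have e144 : Real.log 144 = 4 * Real.log 2 + 2 * Real.log 3 := by
    rw [show (144 : ℝ) = 2 ^ 4 * 3 ^ 2 by norm_num, Real.log_mul (by norm_num) (by norm_num), Real.log_pow, Real.log_pow]
    push_cast; ring
  have e56 : Real.log 56 = 3 * Real.log 2 + Real.log 7 := by
    rw [show (56 : ℝ) = 2 ^ 3 * 7 by norm_num, Real.log_mul (by norm_num) (by norm_num), Real.log_pow]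
    push_cast; ring
  constructor
  · rw [e144]; linarith
  · rw [e56]; linarith

/-- **Every EVEN character of modulus `q ≥ 144` satisfies Weil positivity on `[-1, 1]`** (`J = 80` cells, two layers;
budget `1.1447299 + 4.22745354 − 2.4916 + 2.0866 = 4.9670835 ≤ 4.9698132 ≤ log 144`).
[cite: Weil1952FormulesExplicites, (11) and the «lemme» p. 262; Yoshida1992, §6] -/
theorem weilPositivityOnChar_one_of_even_ge_144 (hq : 144 ≤ q) (χ : DirichletCharacter ℂ q) (hχ : χ.Even) :
    WeilPositivityOnChar χ 1 := by
  have hq1 : q ≠ 1 := by omega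
  have hlog := log_144_56_ge.1.trans (log_le_log_natCast (by norm_num) hq)
  have hπ := Literature.Analysis.SpecialFunctions.Real.log_pi_le
  exact weilPositivityOnChar_of_phi_budget_layers hq1 χ (charParity_of_even hχ) one_pos exp_two_le_eight 2
    psi_even_ge gamma_one_even_two_layers (by norm_num : 0 < 80) phiOne80 (by norm_num : (0 : ℝ) < (647 / 2500 : ℝ))
    one80_philo one80_phihi one80_phiout sOne80 one80_shifts wbar7 (wbar7_ge 7 le_rfl) one80_cert (by linarith)

/-- **Every ODD character of modulus `q ≥ 56` satisfies Weil positivity on `[-1, 1]`** (budget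
`1.1447299 + 1.08586154 − 0.3147 + 2.0866 = 4.0024915 ≤ 4.0160258 ≤ log 56`).
[cite: Weil1952FormulesExplicites, (11) and the «lemme» p. 262; Yoshida1992, §6] -/
theorem weilPositivityOnChar_one_of_odd_ge_56 [NeZero q] (hq : 56 ≤ q) (χ : DirichletCharacter ℂ q) (hχ : χ.Odd) :
    WeilPositivityOnChar χ 1 := by
  have hq1 : q ≠ 1 := by omega
  have hlog := log_144_56_ge.2.trans (log_le_log_natCast (by norm_num) hq)
  have hπ := Literature.Analysis.SpecialFunctions.Real.log_pi_le
  exact weilPositivityOnChar_of_phi_budget_layers hq1 χ (charParity_of_odd hχ) one_pos exp_two_le_eight 2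
    psi_odd_ge gamma_one_odd_two_layers (by norm_num : 0 < 80) phiOne80 (by norm_num : (0 : ℝ) < (647 / 2500 : ℝ))
    one80_philo one80_phihi one80_phiout sOne80 one80_shifts wbar7 (wbar7_ge 7 le_rfl) one80_cert (by linarith)

/-- **UNIFORM FLOOR AT `t = 1`: every Dirichlet character (any parity, any values, primitive or not) of every modulus
`q ≥ 144` satisfies `WeilPositivityOnChar χ 1`** — certificate-free, no `ζ` input. [cite: Weil1952FormulesExplicites, (11) and the «lemme» p. 262; Yoshida1992, §6] -/
theorem weilPositivityOnChar_one_of_ge_144 (hq : 144 ≤ q) (χ : DirichletCharacter ℂ q) :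
    WeilPositivityOnChar χ 1 := by
  haveI : NeZero q := ⟨by omega⟩
  rcases χ.even_or_odd with h | h
  · exact weilPositivityOnChar_one_of_even_ge_144 hq χ h
  · exact weilPositivityOnChar_one_of_odd_ge_56 (by omega) χ h

/-- … hence every rung `t ≤ 1` for every character of modulus `q ≥ 144`. [folklore] -/
theorem weilPositivityOnChar_of_le_one_of_ge_144 (hq : 144 ≤ q) (χ : DirichletCharacter ℂ q) {t : ℝ}
    (ht : t ≤ 1) : WeilPositivityOnChar χ t :=
  (weilPositivityOnChar_one_of_ge_144 hq χ).mono ht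

end UniformFloor

end Summit.Ventures.WeilGRH

end
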